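import Summits.Ventures.PercRepro.S1NullityCells
import Summits.Ventures.PercRepro.S1CellTenNine

/-!
# PercRepro — THE CELL `(10, 5)` OF THE `q = 4` WINDOW BY THE KILL AND NULLITY LEVERS (p2, gen 22; SUBCLAIM-S1 §6.7)

The cell `(10, 5)` (`15` points, the smallest open cell of the row `p = 10`; `1.1332` in the caps-only form): the
coloop-free case at the actual triangle count `t = s₃ ≤ 6` on the lever caps `(t, 21, 78)` — `t ≤ 4` by the kill of
`mk t` triangles alone (`792·m − 252·C(m, 2)` dependent `10`-sets), `t = 5` with the exclusion of the independent
four-sets with all `4` points outside a nullity-`2` set of two triangles (`C(m, 4) − 21 − 3·12 ≥ 69` of them at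
`m = |E ∖ S| ≥ 9`), `t = 6` with `≥ 3` points outside a nullity-`3` set of three triangles
(`C(m, 3)·(15 − m) + C(m, 4) − 21 − 36 ≥ 138` at `m ≥ 6`); one coloop (`p = 9` on `14` points, caps `6 / 22 / 80`,
credit `2^14 − W₃⁺(14)`) likewise, with the nullity-`3` set at `t = 6`; two coloops by the plain ladder; `c ≥ 3`
lossy (`14 ≥ Φ(10, 4) = 13.43`). Exact-integer twin mining/p2/g22/gen105.py.

* `mkTenFive0`, `rrTenFive0`, `mkTenFive1`, `rrTenFive1` — the tables (triangles in the kill / in the nullity set per `t`);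
* **`c025_core_ten_five`**.
Axioms: standard.
-/

open scoped Matroid

namespace PercRepro

namespace S1

open Set

variable {α : Type}

/-- The triangles in the kill at each `t = s₃` (coloop-free case). -/
def mkTenFive0 (t : ℕ) : ℕ := [0, 1, 1, 1, 2, 4, 4].getD t 0

/-- The size `r` of the nullity set at each `t` (coloop-free case; `0` = no exclusion). -/
def rrTenFive0 (t : ℕ) : ℕ := [0, 0, 0, 0, 0, 2, 3].getD t 0

/-- The triangles in the kill at each `t` (one coloop). -/
def mkTenFive1 (t : ℕ) : ℕ := [0, 1, 1, 1, 1, 2, 4].getD t 0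

/-- The size of the nullity set at each `t` (one coloop). -/
def rrTenFive1 (t : ℕ) : ℕ := [0, 0, 0, 0, 0, 0, 3].getD t 0

/-- **THE CELL `(10, 5)`**: an `e`-free core of rank `10` with `15` points satisfies `RLS` at level `4`. -/
theorem c025_core_ten_five (M : Matroid α) [M.Finite] (hR : M.eRank = (10 : ℕ)) (hn : M.E.ncard = 15)
    (hfree : ∀ e ∈ M.E, ∃ A ⊆ M.E \ {e}, e ∉ M.closure A ∧ e ∉ M.closure ((M.E \ {e}) \ A)) :
    ThmN.RLS M 10 4 := by
  rcases (show M.coloops.ncard = 0 ∨ M.coloops.ncard = 1 ∨ M.coloops.ncard = 2 ∨ 3 ≤ M.coloops.ncard by omega)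
    with h | h | h | h
  · exact rls_of_ladder_case_killnull M (p := 10) (c := 0) (d := 5) (by norm_num) (by norm_num) hR hn hfree h
      (by norm_num) (by norm_num) (P := 6) (S := 21) (S5 := 78) (by decide) (by decide) (by decide)
      mkTenFive0 rrTenFive0 (by decide) (by decide) (by decide +kernel) (by decide +kernel) (by decide +kernel)
  · exact rls_of_ladder_case_killnull M (p := 9) (c := 1) (d := 5) (by norm_num) (by norm_num) hR hn hfree h
      (by norm_num) (by norm_num) (P := 6) (S := 22) (S5 := 80) (by decide) (by decide) (by decide)
      mkTenFive1 rrTenFive1 (by decide) (by decide) (by decide +kernel) (by decide +kernel) (by decide +kernel)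
  · exact rls_of_ladder_case M (p := 8) (c := 2) (d := 5) (by norm_num) (by norm_num) hR hn hfree h
      (by norm_num) (by norm_num) (P := 6) (S := 23) (S5 := 84) (by decide) (by decide) (by decide)
      (by decide +kernel)
  · exact rls_of_coloops_lossy M (p := 7) (c := 3) (hR.trans (by norm_num)) (by norm_num) h phiK_ten_four_le

end S1

end PercRepro
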